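import Literature.AnabelianGeometry.AbsoluteAnabelian.GaloisSectionsFacts
import HarnessLib

/-!
# [GalSect] Cor. 3.2 as typed (FACT-LIST F-0100): pointwise form, symmetry, transitivity, self-case

S. Mochizuki, *Galois sections in absolute anabelian geometry*, Nagoya Math. J. 179 (2005) 17–45
[MochizukiGalSect2005]; locators `p.N` = kurims manuscript pages as in the trunk file (journal page in
brackets): Cor. 3.2 p. 14 [p. 32] ("Absoluteness of decomposition groups for genus zero": "every isomorphism
of profinite groups `α : Π_{X_K} ⥲ Π_{Y_L}` preserves the decomposition groups of the closed points"; its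
special case `X_K = Y_L` of genus zero is Thm. A p. 1).

PROOF-ONLY companion (no definition, no instance, no structure) of `GaloisSectionsFacts.lean`
(abc-iut-L4-t16; imported, never edited), cell abc-iut, block F, seat abc-iut-f-096 (tranche 96, row
**F-0100** `GalSect.Cor_3_2`; class `preparatory`, kernel_closedness `parametrised`; sibling file
`GaloisSectionsFactsLem31LimitOfSections.lean` treats F-0101).  The universal closure of the row is refuted
(`GaloisSectionsFactsSchemaNegative.lean`, `not_forall_cor_3_2`): the predicate `Cor_3_2 P Q` — every
`α : Π_{X_K} ⥲ Π_{Y_L}` carries the SET of decomposition groups of closed points of `X_K` (all conjugates of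
the chosen `D_x`) onto that of `Y_L` — is a HYPOTHESIS on the point data `(P, Q)`, admissible at instances
only.  What the kernel CAN say about it:

* `cor_3_2_iff` — the typed set equality is EQUIVALENT to the pointwise reading of print's "preserves the
  decomposition groups of the closed points": every `α : Π_{X_K} ⥲ Π_{Y_L}` carries each `D_x` to a
  `Π_{Y_L}`-conjugate of some `D_y`, AND every `β : Π_{Y_L} ⥲ Π_{X_K}` carries each `D_y` to a
  `Π_{X_K}`-conjugate of some `D_x` (by the conjugation-equivariance `α(g D g⁻¹) = α(g) α(D) α(g)⁻¹`);
* `cor_3_2_symm`, `cor_3_2_trans` (given one isomorphism `Π_{X_K} ⥲ Π_{Y_L}`), `cor_3_2_self_iff` (the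
  self-case `X_K = Y_L`: every continuous automorphism of `Π_{X_K}` permutes the decomposition groups up to
  conjugacy — the shape of Thm. A p. 1 for the decomposition data `P`), `cor_3_2_of_isEmpty`, and the
  necessary condition `nonempty_point_iff_of_cor_3_2` (cf. `not_cor_3_2_of_isEmpty` of the negative
  companion; the degenerate instance with all `D_x = Π` is `cor_3_2_of_decomp_eq_top` in
  `CurveModelFactsNonVacuity.lean`).

HONEST FRAMING: statements about the cell's TYPED predicate over abstract profinite group data, proved by
elementary group theory; Cor. 3.2 itself (about hyperbolic curves over finite extensions of `ℚ_p` defined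
over number fields and isogenous to genus zero) is a refereed, undisputed result that the tree types
statements-first (D-0014) and does not prove; no model of any curve is asserted to exist; typed ≠ proved;
nothing here bears on the disputed [IUTchIII] Cor. 3.12; no side taken.
-/

noncomputable section

open scoped Classical Pointwise

namespace Literature.AnabelianGeometry.AbsoluteAnabelian.GalSect

universe u

variable {E F L : FundamentalExtension.{u}}

/-! ### Conjugation-equivariance helper -/

/-- `f(g K g⁻¹) = f(g) f(K) f(g)⁻¹` for a group homomorphism `f` (private helper). [folklore] -/
private theorem map_conj_smul_eq {G H : Type*} [Group G] [Group H] (f : G →* H) (g : G) (K : Subgroup G) :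
    (MulAut.conj g • K).map f = MulAut.conj (f g) • K.map f := by
  ext y
  constructor
  · rintro ⟨x, hx, rfl⟩
    obtain ⟨k, hk, rfl⟩ := (Subgroup.mem_smul_pointwise_iff_exists _ _ _).mp hx
    refine (Subgroup.mem_smul_pointwise_iff_exists _ _ _).mpr ⟨f k, ⟨k, hk, rfl⟩, ?_⟩
    simp only [MulAut.smul_def, MulAut.conj_apply, map_mul, map_inv]
  · intro hy
    obtain ⟨z, ⟨k, hk, rfl⟩, rfl⟩ := (Subgroup.mem_smul_pointwise_iff_exists _ _ _).mp hy
    refine ⟨g * k * g⁻¹, (Subgroup.mem_smul_pointwise_iff_exists _ _ _).mpr ⟨k, hk, rfl⟩, ?_⟩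
    simp only [MulAut.smul_def, MulAut.conj_apply, map_mul, map_inv]

/-! ### F-0100: `Cor_3_2 P Q` in pointwise form -/

/-- `D_x` belongs to the set of decomposition groups. [cite: MochizukiGalSect2005, §1 p.6] -/
theorem decomp_mem_decompositionGroups (P : PointData E) (x : P.Point) :
    P.decomp x ∈ P.decompositionGroups :=
  ⟨x, 1, by rw [map_one, one_smul]⟩

/-- The set of decomposition groups is stable under `Π`-conjugation. [cite: MochizukiGalSect2005, §1 p.6] -/
theorem conj_smul_mem_decompositionGroups (P : PointData E) {D : Subgroup E.arith}
    (hD : D ∈ P.decompositionGroups) (g : E.arith) : MulAut.conj g • D ∈ P.decompositionGroups := by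
  obtain ⟨x, g', rfl⟩ := hD
  exact ⟨x, g * g', by rw [map_mul, mul_smul]⟩

/-- Transport back and forth along `α : Π_{X_K} ⥲ Π_{Y_L}` is the identity on subgroups.
[cite: MochizukiGalSect2005, Cor 3.2 p.14] -/
theorem map_symm_map (α : E.arith ≃ₜ* F.arith) (H : Subgroup F.arith) :
    (H.map α.symm.toMonoidHom).map α.toMonoidHom = H := by
  ext y
  constructor
  · rintro ⟨x, ⟨z, hz, rfl⟩, rfl⟩
    show α (α.symm z) ∈ H
    rw [α.apply_symm_apply]
    exact hz
  · intro hy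
    exact ⟨α.symm.toMonoidHom y, ⟨y, hy, rfl⟩, α.apply_symm_apply y⟩

/-- **FACT-LIST F-0100, pointwise form.**  The typed Cor. 3.2 — every `α : Π_{X_K} ⥲ Π_{Y_L}` carries
the SET of decomposition groups of closed points of `X_K` onto that of `Y_L` — is equivalent to: every
`α` carries each `D_x` to a `Π_{Y_L}`-conjugate of some `D_y`, AND every `β : Π_{Y_L} ⥲ Π_{X_K}` carries
each `D_y` to a `Π_{X_K}`-conjugate of some `D_x` ("preserves the decomposition groups of the closed
points", read in both directions). [cite: MochizukiGalSect2005, Cor 3.2 p.14] -/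
theorem cor_3_2_iff (P : PointData E) (Q : PointData F) :
    Literature.AnabelianGeometry.AbsoluteAnabelian.GalSect.Cor_3_2 P Q ↔
      (∀ (α : E.arith ≃ₜ* F.arith) (x : P.Point), ∃ (y : Q.Point) (h : F.arith),
          (P.decomp x).map α.toMonoidHom = MulAut.conj h • Q.decomp y) ∧
        ∀ (β : F.arith ≃ₜ* E.arith) (y : Q.Point), ∃ (x : P.Point) (g : E.arith),
          (Q.decomp y).map β.toMonoidHom = MulAut.conj g • P.decomp x := by
  constructor
  · intro H
    refine ⟨fun α x => ?_, fun β y => ?_⟩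
    · have hmem : (P.decomp x).map α.toMonoidHom ∈
          (fun D : Subgroup E.arith => D.map α.toMonoidHom) '' P.decompositionGroups :=
        Set.mem_image_of_mem _ (decomp_mem_decompositionGroups P x)
      rw [H α] at hmem
      obtain ⟨y, h, hy⟩ := hmem
      exact ⟨y, h, hy⟩
    · have hmem : Q.decomp y ∈
          (fun D : Subgroup E.arith => D.map β.symm.toMonoidHom) '' P.decompositionGroups := by
        rw [H β.symm]
        exact decomp_mem_decompositionGroups Q y
      obtain ⟨D, ⟨x, g, rfl⟩, hD⟩ := hmem
      refine ⟨x, g, ?_⟩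
      rw [← hD]
      exact map_symm_map β _
  · rintro ⟨hA, hB⟩ α
    ext D'
    constructor
    · rintro ⟨D, ⟨x, g, rfl⟩, rfl⟩
      obtain ⟨y, h, hy⟩ := hA α x
      show (MulAut.conj g • P.decomp x).map α.toMonoidHom ∈ Q.decompositionGroups
      rw [map_conj_smul_eq, hy]
      exact conj_smul_mem_decompositionGroups Q
        (conj_smul_mem_decompositionGroups Q (decomp_mem_decompositionGroups Q y) h) _
    · rintro ⟨y, h, rfl⟩
      obtain ⟨x, g, hx⟩ := hB α.symm y
      refine ⟨MulAut.conj (α.symm h * g) • P.decomp x, ⟨x, α.symm h * g, rfl⟩, ?_⟩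
      show (MulAut.conj (α.symm h * g) • P.decomp x).map α.toMonoidHom = MulAut.conj h • Q.decomp y
      rw [map_conj_smul_eq, map_mul, map_mul, mul_smul, ← map_conj_smul_eq, ← hx, map_symm_map]
      exact congrArg (fun k => MulAut.conj k • Q.decomp y) (α.apply_symm_apply h)

/-- **Symmetry**: the typed Cor. 3.2 for `(X_K, Y_L)` implies it for `(Y_L, X_K)`.
[cite: MochizukiGalSect2005, Cor 3.2 p.14] -/
theorem cor_3_2_symm {P : PointData E} {Q : PointData F}
    (h : Literature.AnabelianGeometry.AbsoluteAnabelian.GalSect.Cor_3_2 P Q) :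
    Literature.AnabelianGeometry.AbsoluteAnabelian.GalSect.Cor_3_2 Q P :=
  (cor_3_2_iff Q P).2 ⟨((cor_3_2_iff P Q).1 h).2, ((cor_3_2_iff P Q).1 h).1⟩

/-- **Transitivity** along a given isomorphism `β : Π_{X_K} ⥲ Π_{Y_L}`: every `γ : Π_{X_K} ⥲ Π_{Z_M}`
factors as `β` followed by `β⁻¹γ : Π_{Y_L} ⥲ Π_{Z_M}`. [cite: MochizukiGalSect2005, Cor 3.2 p.14] -/
theorem cor_3_2_trans {P : PointData E} {Q : PointData F} {R : PointData L}
    (hPQ : Literature.AnabelianGeometry.AbsoluteAnabelian.GalSect.Cor_3_2 P Q)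
    (hQR : Literature.AnabelianGeometry.AbsoluteAnabelian.GalSect.Cor_3_2 Q R)
    (β : E.arith ≃ₜ* F.arith) :
    Literature.AnabelianGeometry.AbsoluteAnabelian.GalSect.Cor_3_2 P R := by
  intro γ
  have hcomp : ∀ D : Subgroup E.arith,
      D.map γ.toMonoidHom = (D.map β.toMonoidHom).map (β.symm.trans γ).toMonoidHom := fun D => by
    rw [Subgroup.map_map]
    congr 1
    ext x
    show γ x = γ (β.symm (β x))
    rw [β.symm_apply_apply]
  have himg : (fun D : Subgroup E.arith => D.map γ.toMonoidHom) '' P.decompositionGroups =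
      (fun D : Subgroup F.arith => D.map (β.symm.trans γ).toMonoidHom) ''
        ((fun D : Subgroup E.arith => D.map β.toMonoidHom) '' P.decompositionGroups) := by
    rw [Set.image_image]
    exact Set.image_congr fun D _ => hcomp D
  rw [himg, hPQ β, hQR (β.symm.trans γ)]

/-- **Self-case** (`Y_L = X_K`): the typed Cor. 3.2 for `(X_K, X_K)` says exactly that every
(continuous) automorphism of `Π_{X_K}` carries each decomposition group of a closed point to a conjugate
of one — the shape of Thm. A p. 1 for the decomposition data `P`. [cite: MochizukiGalSect2005, Cor 3.2 p.14] -/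
theorem cor_3_2_self_iff (P : PointData E) :
    Literature.AnabelianGeometry.AbsoluteAnabelian.GalSect.Cor_3_2 P P ↔
      ∀ (α : E.arith ≃ₜ* E.arith) (x : P.Point), ∃ (y : P.Point) (h : E.arith),
        (P.decomp x).map α.toMonoidHom = MulAut.conj h • P.decomp y :=
  (cor_3_2_iff P P).trans and_self_iff

/-- Pointless instance: with no closed points declared on either side the typed Cor. 3.2 holds (both sets
of decomposition groups are empty). [cite: MochizukiGalSect2005, Cor 3.2 p.14] -/
theorem cor_3_2_of_isEmpty (P : PointData E) (Q : PointData F) [IsEmpty P.Point] [IsEmpty Q.Point] :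
    Literature.AnabelianGeometry.AbsoluteAnabelian.GalSect.Cor_3_2 P Q :=
  (cor_3_2_iff P Q).2 ⟨fun _ x => isEmptyElim x, fun _ y => isEmptyElim y⟩

/-- Necessary condition: under the typed Cor. 3.2, as soon as `Π_{X_K} ≅ Π_{Y_L}` at all, `X_K` has a
declared closed point iff `Y_L` does (cf. `not_cor_3_2_of_isEmpty`). [cite: MochizukiGalSect2005, Cor 3.2 p.14] -/
theorem nonempty_point_iff_of_cor_3_2 {P : PointData E} {Q : PointData F}
    (h : Literature.AnabelianGeometry.AbsoluteAnabelian.GalSect.Cor_3_2 P Q) (α : E.arith ≃ₜ* F.arith) :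
    Nonempty P.Point ↔ Nonempty Q.Point := by
  obtain ⟨hA, hB⟩ := (cor_3_2_iff P Q).1 h
  refine ⟨fun ⟨x⟩ => ?_, fun ⟨y⟩ => ?_⟩
  · obtain ⟨y, -, -⟩ := hA α x
    exact ⟨y⟩
  · obtain ⟨x, -, -⟩ := hB α.symm y
    exact ⟨x⟩

end Literature.AnabelianGeometry.AbsoluteAnabelian.GalSect
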